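import Mathlib
import Summits.CriticalPhenomena.PercolationContinuityZ3.Theorems.PercAxialLogConvexityAxialLogConvexTubeLimit
import HarnessLib

/-!
# Crux `AxialLogConvex` (stmt-CriticalPhenomena-11549), line `registered` — the open stub
`stub_torusTubeLCX` follows from STRICT axial log-convexity on `ℤ³` below `p_c`

Lead c3's audit of the line (a delimiter, not progress on the crux): by the landed `k → ∞`
transport `tendsto_torusTube_axial` (`a_k(p,n) := P_p^{T_k}((0,0) ↔ ((n),0)) → τ_p(0, n e₁)`,
`T_k = zdGraph 1 □ torusGraph 2 k`), the frequently-in-`k` tube log-convexity asked by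
`stub_torusTubeLCX` at `(p, n)` holds as soon as log-convexity of `n ↦ τ_p(0, n e₁)` on `ℤ³`
holds STRICTLY at `(p, n)`; conversely (line `registered`, `AxialLogConvex_of`) the stub gives
the crux. So, in its weakened (frequently-in-`k`) form, the remaining stub is sandwiched between
the crux restricted to `p < p_c` and its strict version: the torus-tube detour buys nothing
unless log-convexity on `T_k` is proved for individual widths `k` by tube-specific structure
(finite transfer matrix), which is what the original all-`k` stub asked.

* `torusTubeLCX_frequently_of_strict` — strict LCX of `τ_p(0, · e₁)` at `(p, n)` ⇒ LCX of
  `a_k(p, ·)` at `n` eventually (hence frequently) in `k`;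
* `stub_torusTubeLCX_of_strictAxialLogConvex` — the registered stub's statement from strict
  axial log-convexity on `ℤ³` for all `p < p_c`, `n`.
-/

noncomputable section

namespace Summit.CriticalPhenomena.PercolationContinuityZ3.Theorems.AxialLogConvex

open Filter Topology MeasureTheory

/-- Strict log-convexity of `n ↦ τ_p(0, n e₁)` at `(p, n)` passes to the torus tubes `T_k` for all
large widths `k`, by `a_k(p, m) → τ_p(0, m e₁)` (`tendsto_torusTube_axial`) at `m = n, n+1, n+2`
and continuity of `(x, y, z) ↦ x z − y²`. [folklore] -/
theorem torusTubeLCX_eventually_of_strict (p : unitInterval) (n : ℕ)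
    (h : Literature.Probability.Percolation.tau 3 p 0 (Pi.single 0 ((n + 1 : ℕ) : ℤ)) ^ 2 <
      Literature.Probability.Percolation.tau 3 p 0 (Pi.single 0 (n : ℤ)) *
        Literature.Probability.Percolation.tau 3 p 0 (Pi.single 0 ((n + 2 : ℕ) : ℤ))) :
    ∀ᶠ k : ℕ in atTop,
      (Literature.Probability.Percolation.bondPercolation ((Literature.Probability.LatticeModels.zdGraph 1).boxProd (Literature.Probability.LatticeModels.torusGraph 2 k)) p).real (Literature.Probability.Percolation.openConn (0 : Literature.Probability.LatticeModels.Site 1 × Literature.Probability.LatticeModels.TorusSite 2 k) ((fun _ => ((n + 1 : ℕ) : ℤ)), 0)) ^ 2 ≤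
        (Literature.Probability.Percolation.bondPercolation ((Literature.Probability.LatticeModels.zdGraph 1).boxProd (Literature.Probability.LatticeModels.torusGraph 2 k)) p).real (Literature.Probability.Percolation.openConn (0 : Literature.Probability.LatticeModels.Site 1 × Literature.Probability.LatticeModels.TorusSite 2 k) ((fun _ => (n : ℤ)), 0)) *
          (Literature.Probability.Percolation.bondPercolation ((Literature.Probability.LatticeModels.zdGraph 1).boxProd (Literature.Probability.LatticeModels.torusGraph 2 k)) p).real (Literature.Probability.Percolation.openConn (0 : Literature.Probability.LatticeModels.Site 1 × Literature.Probability.LatticeModels.TorusSite 2 k) ((fun _ => ((n + 2 : ℕ) : ℤ)), 0)) := by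
  have t0 := tendsto_torusTube_axial p n
  have t1 := tendsto_torusTube_axial p (n + 1)
  have t2 := tendsto_torusTube_axial p (n + 2)
  have hlim := (t0.mul t2).sub (t1.pow 2)
  have hpos : (0 : ℝ) < Literature.Probability.Percolation.tau 3 p 0 (Pi.single 0 (n : ℤ)) *
      Literature.Probability.Percolation.tau 3 p 0 (Pi.single 0 ((n + 2 : ℕ) : ℤ)) -
        Literature.Probability.Percolation.tau 3 p 0 (Pi.single 0 ((n + 1 : ℕ) : ℤ)) ^ 2 :=
    sub_pos.2 h
  filter_upwards [hlim.eventually_const_lt hpos] with k hk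
  linarith

/-- **The open stub from strict `ℤ³` log-convexity.** If `n ↦ τ_p(0, n e₁)` is STRICTLY
log-convex for every `p < p_c(ℤ³)`, then the registered stub `stub_torusTubeLCX` of line
`registered` holds (its statement verbatim as conclusion): for every `p < p_c` and `n`,
frequently in the width `k`, `a_k(p,n+1)² ≤ a_k(p,n) · a_k(p,n+2)` on
`T_k = zdGraph 1 □ torusGraph 2 k`. [folklore] -/
theorem stub_torusTubeLCX_of_strictAxialLogConvex :
    (∀ p : unitInterval, p < Literature.Probability.Percolation.criticalProbI 3 → ∀ n : ℕ, Literature.Probability.Percolation.tau 3 p 0 (Pi.single 0 ((n + 1 : ℕ) : ℤ)) ^ 2 < Literature.Probability.Percolation.tau 3 p 0 (Pi.single 0 (n : ℤ)) * Literature.Probability.Percolation.tau 3 p 0 (Pi.single 0 ((n + 2 : ℕ) : ℤ))) →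
    ∀ p : unitInterval, p < Literature.Probability.Percolation.criticalProbI 3 → ∀ n : ℕ, ∃ᶠ k : ℕ in Filter.atTop, (Literature.Probability.Percolation.bondPercolation ((Literature.Probability.LatticeModels.zdGraph 1).boxProd (Literature.Probability.LatticeModels.torusGraph 2 k)) p).real (Literature.Probability.Percolation.openConn (0 : Literature.Probability.LatticeModels.Site 1 × Literature.Probability.LatticeModels.TorusSite 2 k) ((fun _ => ((n + 1 : ℕ) : ℤ)), 0)) ^ 2 ≤ (Literature.Probability.Percolation.bondPercolation ((Literature.Probability.LatticeModels.zdGraph 1).boxProd (Literature.Probability.LatticeModels.torusGraph 2 k)) p).real (Literature.Probability.Percolation.openConn (0 : Literature.Probability.LatticeModels.Site 1 × Literature.Probability.LatticeModels.TorusSite 2 k) ((fun _ => (n : ℤ)), 0)) * (Literature.Probability.Percolation.bondPercolation ((Literature.Probability.LatticeModels.zdGraph 1).boxProd (Literature.Probability.LatticeModels.torusGraph 2 k)) p).real (Literature.Probability.Percolation.openConn (0 : Literature.Probability.LatticeModels.Site 1 × Literature.Probability.LatticeModels.TorusSite 2 k) ((fun _ => ((n + 2 : ℕ) : ℤ)),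 0)) := by
  intro h p hp n
  exact (torusTubeLCX_eventually_of_strict p n (h p hp n)).frequently

end Summit.CriticalPhenomena.PercolationContinuityZ3.Theorems.AxialLogConvex

end
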